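import Mathlib
import Literature.Probability.Percolation.HierarchicalDecomposition
import Literature.Probability.Percolation.Percolation
import Literature.Probability.Percolation.SharpnessDCTProofs
import Literature.Probability.Percolation.BernoulliPercolation
import Literature.Probability.Percolation.SiteConnectionTools
import Literature.Probability.Percolation.BondPercolationSymmetry
import Literature.Probability.Percolation.PercolationProofs
import Literature.Probability.Percolation.HalfSpacePinnedPairs
import Literature.Probability.Percolation.FiniteEnergy

/-!
# `FragileWeavingGiantExists` (stmt-CriticalPhenomena-5266) — definitions

Support item `FragileWeavingGiantExists` of route `PercThresholdOne`
(`Summit.CriticalPhenomena.PercolationContinuityZ3.Theses.PercThresholdOne.FragileWeavingGiantExists`) asks for a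
probability measure on nearest-neighbour bond configurations of `ℤ³`, invariant under translations, coordinate
permutations and the reflection of the first coordinate, almost surely a dense, uniquely percolating and WEAVING
configuration (all clusters inside coordinate half-spaces finite), which is exponentially subcritical under every
independent `q`-thinning, `q < 1`.  The route card proposed the uniform spanning tree of `ℤ³`; the witness built in
this series of files is elementary instead: the law of a **stationary hierarchical spanning tree** of `ℤ³`,
symmetrised over the `48` signed permutations of the coordinates.

Construction.  The randomness `ω : Ω = ℕ → P`, `P = {0,1,2}³`, is an i.i.d. sequence of uniform digit vectors
(`μ`, the Haar measure of `ℤ₃³` in digit coordinates); `digit ω x m` is the `m`-th `3`-adic digit vector of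
`x + S(ω)`, i.e. the position of the level-`m` block `blk ω m x` (a lattice cube of side `3^m`, in the format of
`HierarchicalDecomposition`) inside its parent block.  Inside a block with *exit corner type* `t : K4` the `27`
sub-blocks are routed toward the corner sub-block `pos t` by the fixed pattern `qstep` (along a short path through
the centre, otherwise toward the centre); a sub-block at position `a` is left through the corner `nextType a t`
(the all-max corner for a positive step, the `i`-min corner for `-eᵢ`), which gives the backward recursion
`exitType` for the exit corners (evaluated from the first synchronising level `syncLevel`, where the recursion
forgets its input).  The parent `par ω x` of a site is one lattice step in the direction `parDir ω x`: inside the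
smallest block of which `x` is not the exit corner (`jlev`), the routing step of its sub-block.  `treeConfig ω` is
the set of edges `{x, par x}`; `ν0` its law, `νsym` the symmetrisation.  This file only contains the definitions
(and the two trivial probability instances); all statements are proved in the sibling files
`PercThresholdOneFragileWeavingGiantExists*.lean`.
-/

noncomputable section

namespace Summit.CriticalPhenomena.PercolationContinuityZ3.Theorems.FragileGiant

open MeasureTheory
open scoped ENNReal
open Literature.Probability.Percolation Literature.Probability.LatticeModels
open Literature.Probability.Percolation.DCT16

/-- Positions of a sub-block inside its parent block (= digit vectors), `{0,1,2}³`. -/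
abbrev P : Type := Fin 3 → Fin 3

/-- Exit-corner types: `none` is the all-max corner `(1,1,1)`, `some i` the corner whose `i`-th coordinate is
minimal and whose other coordinates are maximal. -/
abbrev K4 : Type := Option (Fin 3)

/-- Unit directions: `(i, true)` is `+eᵢ`, `(i, false)` is `-eᵢ`. -/
abbrev Dir : Type := Fin 3 × Bool

/-- The position of the corner sub-block of type `t`: `(2,2,2)` for `none`, and `(2,2,2)` with the `i`-th entry
replaced by `0` for `some i`. -/
def pos (t : K4) : P := fun i => if t = some i then 0 else 2

/-- The centre position `(1,1,1)`. -/
def center : P := fun _ => 1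

/-- The leaf position `b0 = (0,0,0)`. -/
def b0 : P := fun _ => 0

/-- The `k`-th point of the routing path toward `t`: `(1,1,1)`, `(q₀,1,1)`, `(q₀,q₁,1)`, `q = pos t` for
`k = 0,1,2,3`. -/
def pathPt (t : K4) (k : ℕ) : P := fun i => if (i : ℕ) < k then pos t i else 1

/-- The direction from an off-centre position toward the centre: move the first coordinate different from `1`
toward `1`. (Junk `(2, false)` at the centre itself.) -/
def toCenterDir (s : P) : Dir :=
  if s 0 ≠ 1 then (0, decide (s 0 = 0))
  else if s 1 ≠ 1 then (1, decide (s 1 = 0))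
  else (2, decide (s 2 = 0))

/-- The routing step from position `s` toward the corner position `pos t`. -/
def qstep (s : P) (t : K4) : Dir :=
  if s = pathPt t 0 then (0, decide (pos t 0 = 2))
  else if s = pathPt t 1 then (1, decide (pos t 1 = 2))
  else if s = pathPt t 2 then (2, decide (pos t 2 = 2))
  else toCenterDir s

/-- A direction is valid at `s` if the corresponding unit step stays inside `{0,1,2}³` (Boolean). -/
def valid (s : P) (d : Dir) : Bool := if d.2 then decide (s d.1 ≠ 2) else decide (s d.1 ≠ 0)

/-- Apply a direction to a position (`Fin 3` arithmetic; only used at valid directions). -/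
def movePos (s : P) (d : Dir) : P :=
  Function.update s d.1 (if d.2 then s d.1 + 1 else s d.1 - 1)

/-- The routing successor of `s` toward `t`. -/
def qnext (s : P) (t : K4) : P := movePos s (qstep s t)

/-- Number of coordinates of `s` different from `1`. -/
def nonOneCount (s : P) : ℕ := (Finset.univ.filter fun i => s i ≠ 1).card

/-- The routing potential: `3,2,1,0` along the path toward `t`, and `3 + #{i | sᵢ ≠ 1}` off the path. -/
def qdist (s : P) (t : K4) : ℕ :=
  if s = pathPt t 0 then 3
  else if s = pathPt t 1 then 2
  else if s = pathPt t 2 then 1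
  else if s = pos t then 0
  else 3 + nonOneCount s

/-- The corner type at which a block is left when its exit step has direction `d`: the all-max corner for a
positive step, the `i`-min corner for the step `-eᵢ`. -/
def cornerOf (d : Dir) : K4 := if d.2 then none else some d.1

/-- The exit-type recursion: the exit corner type of a sub-block at position `a` of a block whose own exit
corner type is `t`. -/
def nextType (a : P) (t : K4) : K4 := if a = pos t then t else cornerOf (qstep a t)

/-- Synchronising positions (Boolean): off all four routing paths (there the routing step does not depend on
the target). -/
def isSync (s : P) : Bool :=
  decide (∀ t : K4, s ≠ pathPt t 0 ∧ s ≠ pathPt t 1 ∧ s ≠ pathPt t 2 ∧ s ≠ pathPt t 3)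

/-- The value of the exit-type recursion at a synchronising position (independent of the target). -/
def syncVal (s : P) : K4 := cornerOf (toCenterDir s)

/-- The synchronising position whose step is `-eᵢ`: `(2,1,0)`, `(1,2,0)`, `(1,1,2)` for `i = 0,1,2`. -/
def syncNeg (i : Fin 3) : P :=
  if i = 0 then ![2, 1, 0] else if i = 1 then ![1, 2, 0] else ![1, 1, 2]

/-- The randomness: a sequence of digit vectors (the `3`-adic coordinates of the origin). -/
abbrev Ω : Type := ℕ → P

/-- Sites of `ℤ³`. -/
abbrev V3 : Type := Fin 3 → ℤ

/-- Partial sums `S_n(ω)_i = ∑_{m<n} ω_{m,i} 3^m`. -/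
def psum (ω : Ω) (n : ℕ) : V3 := fun i => ∑ m ∈ Finset.range n, ((ω m i : ℕ) : ℤ) * 3 ^ m

/-- The `m`-th `3`-adic digit of an integer (Euclidean conventions, correct also for negative integers). -/
def zdigit (y : ℤ) (m : ℕ) : Fin 3 :=
  ⟨((y / 3 ^ m) % 3).toNat, by
    have h1 := Int.emod_nonneg (y / 3 ^ m) (show (3 : ℤ) ≠ 0 by norm_num)
    have h2 := Int.emod_lt_of_pos (y / 3 ^ m) (show (0 : ℤ) < 3 by norm_num)
    omega⟩

/-- The digit vector of the site `x` at level `m`: the `m`-th `3`-adic digits of `x + S(ω)`; it is the position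
of the level-`m` block of `x` inside its level-`(m+1)` block. -/
def digit (ω : Ω) (x : V3) (m : ℕ) : P := fun i => zdigit (x i + psum ω (m + 1) i) m

/-- The offsets of the block decomposition (in the format of `HierarchicalDecomposition`):
`o_n = (-S_n) mod 3^n`. -/
def offs (ω : Ω) : ℕ → V3 := fun n i => (-psum ω n i) % 3 ^ n

/-- The level-`n` block of `x` (a lattice cube of side `3^n`). -/
def blk (ω : Ω) (n : ℕ) (x : V3) : Finset V3 := block 3 (offs ω) n x

/-- The relative position of `x` inside its level-`n` block, coordinatewise in `[0, 3^n)`. -/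
def rel (ω : Ω) (n : ℕ) (x : V3) : V3 := fun i => (x i + psum ω n i) % 3 ^ n

open scoped Classical in
/-- The first synchronising level of `x` at or above `m` (relative index; junk `0` if none). -/
def syncLevel (ω : Ω) (x : V3) (m : ℕ) : ℕ :=
  if h : ∃ j, isSync (digit ω x (m + j)) = true then Nat.find h else 0

/-- Backward exit-type recursion with fuel: start from the synchronised value `j` levels up. -/
def exitTypeAux (ω : Ω) (x : V3) : ℕ → ℕ → K4
  | m, 0 => syncVal (digit ω x m)
  | m, j + 1 => nextType (digit ω x m) (exitTypeAux ω x (m + 1) j)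

/-- **The exit corner type of the level-`m` block of `x`**: the corner of `B_m(x)` through which the tree
leaves `B_m(x)` toward infinity. -/
def exitType (ω : Ω) (x : V3) (m : ℕ) : K4 := exitTypeAux ω x m (syncLevel ω x m)

open scoped Classical in
/-- **The jump level of `x`**: the first level `m` at which the `m`-block of `x` is not the exit-corner
sub-block of the `(m+1)`-block; `x` is the exit corner of its blocks of all levels `≤ jlev x`
(junk `0` if no such level). -/
def jlev (ω : Ω) (x : V3) : ℕ :=
  if h : ∃ m, digit ω x m ≠ pos (exitType ω x (m + 1)) then Nat.find h else 0

/-- The direction of the tree edge from `x` to its parent. -/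
def parDir (ω : Ω) (x : V3) : Dir := qstep (digit ω x (jlev ω x)) (exitType ω x (jlev ω x + 1))

/-- The lattice unit vector of a direction. -/
def unitVec (d : Dir) : V3 := if d.2 then Pi.single d.1 1 else -Pi.single d.1 1

/-- **The parent of `x`** in the hierarchical tree. -/
def par (ω : Ω) (x : V3) : V3 := x + unitVec (parDir ω x)

/-- **The hierarchical tree** as a bond configuration: the edges `{x, par x}`. -/
def treeConfig (ω : Ω) : Set (Sym2 V3) := Set.range fun x => s(x, par ω x)

/-- The good randomness: every digit vector occurs at arbitrarily high levels in the digit sequence of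
every site. (An event of full measure.) -/
def goodSet : Set Ω := {ω | ∀ (x : V3) (b : P) (M : ℕ), ∃ m, M ≤ m ∧ digit ω x m = b}

/-- The routing potential of `u` at level `m`. -/
def pot (ω : Ω) (u : V3) (m : ℕ) : ℕ := qdist (digit ω u m) (exitType ω u (m + 1))

/-- **The exit vertex of the level-`n` block of `x`**: its corner of type `exitType x n`. -/
def exitVertex (ω : Ω) (n : ℕ) (x : V3) : V3 :=
  fun i => x i - rel ω n x i + (if exitType ω x n = some i then 0 else 3 ^ n - 1)

/-- The first `k` edges of the ancestral chain of `w`. -/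
def upEdges (ω : Ω) (w : V3) (k : ℕ) : Finset (Sym2 V3) :=
  (Finset.range k).image fun t => s((par ω)^[t] w, (par ω)^[t + 1] w)

open scoped Classical in
/-- The first index at which the chain of `v` hits the chain of the origin (junk `0`). -/
def meetI (ω : Ω) (v : V3) : ℕ :=
  if h : ∃ i j, (par ω)^[i] v = (par ω)^[j] 0 then Nat.find h else 0

open scoped Classical in
/-- The index on the chain of the origin of the first meeting point with the chain of `v` (junk `0`). -/
def meetJ (ω : Ω) (v : V3) : ℕ :=
  if h : ∃ j, (par ω)^[meetI ω v] v = (par ω)^[j] 0 then Nat.find h else 0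

/-- The witness edge set for a boundary point: the longer of the two minimal chain segments. -/
def fragEdges (ω : Ω) (v : V3) : Finset (Sym2 V3) :=
  if meetJ ω v ≤ meetI ω v then upEdges ω v (meetI ω v) else upEdges ω 0 (meetJ ω v)

/-- The uniform probability measure on the `27` digit vectors. -/
def unifP : Measure P := (27 : ℝ≥0∞)⁻¹ • Measure.count

/-- There are `27` digit vectors. -/
theorem card_P : Fintype.card P = 27 := by
  rw [Fintype.card_fun, Fintype.card_fin]; norm_num

/-- Values of the uniform measure. -/
theorem unifP_apply (s : Set P) : unifP s = 27⁻¹ * Measure.count s := by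
  simp [unifP]

/-- The uniform measure is a probability measure. -/
instance instIsProbabilityMeasureUnifP : IsProbabilityMeasure unifP := by
  constructor
  rw [unifP_apply, ← Finset.coe_univ, Measure.count_apply_finset, Finset.card_univ, card_P]
  norm_num
  exact ENNReal.inv_mul_cancel (by norm_num) (by norm_num)

/-- **The randomness**: i.i.d. uniform digit vectors (the Haar measure of `ℤ₃³` in digit coordinates). -/
def μ : Measure Ω := Measure.infinitePi fun _ : ℕ => unifP

/-- `μ` is a probability measure. -/
instance instIsProbabilityMeasureμ : IsProbabilityMeasure μ := by
  unfold μ; infer_instance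

/-- The first `n` raw digits. -/
def Dn (n : ℕ) (ω : Ω) : Fin n → P := fun m => ω m

/-- Extension of a finite digit string by the leaf digit. -/
def extω (n : ℕ) (g : Fin n → P) : Ω := fun k => if h : k < n then g ⟨k, h⟩ else b0

/-- The digit-string map of a site `v`: first `n` digits of `v + S(ω)` as a function of the first `n`
raw digits. -/
def βmap (v : V3) (n : ℕ) (g : Fin n → P) : Fin n → P := fun m => digit (extω n g) v m

/-- **The odometer**: the digit sequence of the site `v`, i.e. of `v + S(ω)`. -/
def addω (v : V3) (ω : Ω) : Ω := fun m => digit ω v m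

/-- The signed permutations of the coordinates (the `48` lattice symmetries fixing the origin),
parametrised by a permutation and a sign vector. -/
abbrev SP : Type := Equiv.Perm (Fin 3) × (Fin 3 → ℤˣ)

/-- The lattice map of a signed permutation. -/
def spEquiv (g : SP) : V3 ≃ V3 := Site.signedPerm g.1 g.2

/-- Relabelling a configuration by a map of the vertices (pull-back of edges), in the form used by
the route statement: `ξ ↦ (Sym2.map h)⁻¹(ξ)`. -/
def relab (h : V3 → V3) (ξ : Set (Sym2 V3)) : Set (Sym2 V3) := Sym2.map h ⁻¹' ξ

/-- **The law of the tree.** -/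
def ν0 : Measure (Set (Sym2 V3)) := μ.map treeConfig

/-- **The witness measure**: the law of the tree, symmetrised over the signed permutations. -/
def νsym : Measure (Set (Sym2 V3)) :=
  (Fintype.card SP : ℝ≥0∞)⁻¹ • ∑ g : SP, ν0.map (relab (spEquiv g))

/-- Composition law: `spEquiv g ∘ spEquiv g₀ = spEquiv (spComp g₀ g)`. -/
def spComp (g₀ g : SP) : SP := (g₀.1.trans g.1, fun i => g.2 i * g₀.2 (g.1.symm i))

/-- The almost sure event required by the route statement: nearest-neighbour, uniquely percolating,
weaving configurations. -/
def goodConfigs : Set (Set (Sym2 V3)) :=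
  {ξ | ξ ⊆ (zdGraph 3).edgeSet ∧
    (∀ x y, (openCluster ξ x).Infinite → (openCluster ξ y).Infinite → y ∈ openCluster ξ x) ∧
    (∀ (i : Fin 3) (k : ℤ) (x : V3), {y | ξ ∈ openConnIn {z | k ≤ z i} x y}.Finite ∧
      {y | ξ ∈ openConnIn {z | z i ≤ k} x y}.Finite)}

/-- The thinned one-arm event on pairs. -/
def thinEvent (n : ℕ) : Set (Set (Sym2 V3) × Set (Sym2 V3)) := {π | π.1 ∩ π.2 ∈ siteToBoundary 3 n}

end Summit.CriticalPhenomena.PercolationContinuityZ3.Theorems.FragileGiant
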